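import Summits.HodgeConjecture.CorCM.MumfordTateRankSemisimpleTimesCM
import Summits.HodgeConjecture.CorCM.MumfordTateRankSixIsogeny
import Literature.AlgebraicGeometry.Motives.HodgeLieCenterOfAbelianVarietyProducts
import HarnessLib

/-!
# The centre and the semisimple part of `Lie Hg(H¹(B^{m+1} × Z))`; the semisimple-rank-one rungs as an IFF:
# `dim [Lie Hg, Lie Hg](H¹X) = 3 ⟺ X ∼ B^{m+1} × Z`, `B` a non-CM curve / QM surface, `Z` of CM type

COR-CM (cell `pub-hodgecm2`, seat `b27` gen 43, count-neutral Mumford–Tate-rank ladder; theorems only, no definition, no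
named fact; UNCONDITIONAL — nothing here uses or asserts HC_CM).  Sequel of `CorCM/MumfordTateRankSemisimpleTimesCM`
(`t(B^{m+1} × Z) = t(Z) + 3`) and `CorCM/MumfordTateRankSixIsogeny` (gen 37: `dim [Lie Hg, Lie Hg](H¹X) = 3 ⟹
X ∼ B^{m+1} × Z`), using the Literature file `Motives/HodgeLieCenterOfAbelianVarietyProducts` (`dim 𝔷(H¹X) = dim Lie Hg(H¹X₂)`,
`dim [𝔥, 𝔥](H¹X) = dim Lie Hg(H¹X₁)` for `X ∼ X₁ × X₂` with `Hg(X₁)` semisimple and `X₂` of CM type; isogeny and power invariance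
of `dim 𝔷`, `dim [𝔥, 𝔥]`).

* §1 **`finrank_hodgeLie_center_and_derived_hodge_one_eq_of_isIsogenous_powSucc_prod`** — for `X ∼ B^{m+1} × Z` with `B`
  without factor of type IV and `Z` of CM type: `dim 𝔷(H¹X) = dim Lie Hg(H¹Z)` (the type-IV part of `X` is the CM part) and
  `dim [𝔥, 𝔥](H¹X) = dim Lie Hg(H¹B)` (the semisimple part is `Hg(B)`).
* §2 **`finrank_hodgeLie_derived_hodge_one_eq_three_iff`** — for `0 < dim X`: `dim [Lie Hg, Lie Hg](H¹X) = 3` IFF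
  `X ∼ B^{m+1} × Z` with `B` simple, not of CM type, `0 < dim B ≤ 2`, `dim End⁰B = (dim B)²`, `dim Z(End⁰B) = 1` and `Z` of CM
  type (Moonen–Zarhin's `SL₂ × torus` shapes; `⟹` is gen 37's splitting, `⟸` is new: `dim [𝔥, 𝔥] = dim Lie Hg(H¹B) = 3`).

## References
* [MoonenZarhin1999LowDim] B. Moonen, Yu. Zarhin, Math. Ann. 315 (1999), §2 (2.1)–(2.5), §3 (3.1), Thm. (3.2)(2)
  [corpus: paper:arxiv-math_9901113 pp. 4–6].
* [Deligne1982HodgeCycles] P. Deligne, LNM 900 (1982), I §3.1, Prop. 3.4, Prop. 3.6.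
* [MumfordAV1970] D. Mumford, *Abelian Varieties* (1970), §19 Thm. 1, Cor. 1–2.
-/

noncomputable section

open CategoryTheory CategoryTheory.Limits Module

namespace Summit.HodgeConjecture.CorCM

open Literature.AlgebraicGeometry.Motives
open Literature.AlgebraicGeometry.Motives.AbelianVariety
open Literature.AlgebraicGeometry.Motives.HodgeStructure
open Literature.AlgebraicGeometry.HodgeTheory
open Literature.AlgebraicGeometry.Milne1999 (IsOfCMType)
open Literature.AlgebraicGeometry.Pohlmann1968 (isIsogenous_powSucc_biproduct)

variable [HodgeTensorFacts.{0, 0}] {X : AbelianVariety ℂ} {n : ℕ}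

/-! ### §1 `X ∼ B^{m+1} × Z`: the centre is the CM part, the semisimple part is `Hg(B)` -/

/-- **For `X ∼ B^{m+1} × Z` with `B` without factor of type IV and `Z` of CM type: `dim 𝔷(H¹X) = dim Lie Hg(H¹Z)` and
`dim [Lie Hg, Lie Hg](H¹X) = dim Lie Hg(H¹B)`** (`𝔷 = Lie Hg ∩ End⁰`; Moonen–Zarhin Thm. (3.2)(2) `Hg(B^{m+1} × Z) = Hg(B) × Hg(Z)`
read on the centre and on the derived algebra, `Hg(B^{m+1}) = Hg(B)`). [cite: MoonenZarhin1999LowDim, §3 Thm. (3.2)(2)]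
[cite: MoonenZarhin1999LowDim, §1] [cite: Deligne1982HodgeCycles, I §3 Prop. 3.6] -/
theorem finrank_hodgeLie_center_and_derived_hodge_one_eq_of_isIsogenous_powSucc_prod (hX : IsSmoothProjective n X.X)
    {B Z : AbelianVariety ℂ} {k l : ℕ} (hB : IsSmoothProjective k B.X) (hZ : IsSmoothProjective l Z.X)
    (hA4 : HasNoTypeIVFactor B) (hcm : IsOfCMType Z) {m : ℕ} (h : IsIsogenous X ((B.powSucc m).prod Z)) :
    haveI := BettiUniverse.finite hX 1
    haveI := BettiUniverse.finite hB 1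
    haveI := BettiUniverse.finite hZ 1
    Module.finrank ℚ ↥((BettiUniverse.hodge exists_isReal_hodgeModel_holds hX 1).hodgeLie ⊓
        Subalgebra.toSubmodule (BettiUniverse.hodge exists_isReal_hodgeModel_holds hX 1).endAlg) =
      Module.finrank ℚ (BettiUniverse.hodge exists_isReal_hodgeModel_holds hZ 1).hodgeLie ∧
    Module.finrank ℚ ↥(Submodule.span ℚ {C | ∃ A ∈ (BettiUniverse.hodge exists_isReal_hodgeModel_holds hX 1).hodgeLie,
        ∃ D ∈ (BettiUniverse.hodge exists_isReal_hodgeModel_holds hX 1).hodgeLie, A * D - D * A = C}) =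
      Module.finrank ℚ (BettiUniverse.hodge exists_isReal_hodgeModel_holds hB 1).hodgeLie := by
  have hP : IsSmoothProjective (B.powSucc m).dim (B.powSucc m).X := AbelianVariety.isSmoothProjective_holds
  haveI := BettiUniverse.finite hX 1
  haveI := BettiUniverse.finite hB 1
  haveI := BettiUniverse.finite hZ 1
  haveI := BettiUniverse.finite hP 1
  obtain ⟨hz, hd⟩ := AbelianVariety.finrank_hodgeLie_inf_endAlg_and_derived_hodge_one_eq_of_isIsogenous_prod hX hP hZ h
    (hodgeLie_hodge_one_inf_endAlg_eq_bot_of_hasNoTypeIVFactor hP (hA4.powSucc m))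
    (hodgeLie_hodge_one_comm_of_isOfCMType hZ hcm)
  refine ⟨hz, ?_⟩
  rw [hd]
  exact AbelianVariety.finrank_hodgeLie_hodge_one_eq_of_isIsogenous_biproduct_const hB hP
    (isIsogenous_powSucc_biproduct B m)

/-! ### §2 The semisimple-rank-one rungs as an iff -/

/-- **`dim [Lie Hg, Lie Hg](H¹X) = 3` for EVERY `X ∼ B^{m+1} × Z` with `B` a simple non-CM curve or QM surface
(`0 < dim B ≤ 2`, `dim End⁰B = (dim B)²`, `dim Z(End⁰B) = 1`) and `Z` of CM type** (the semisimple part of `Hg(X)` is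
`Hg(B) = SL₂`-type, `finrank_hodgeLie_hodge_one_eq_three_of_factor`). [cite: MoonenZarhin1999LowDim, §3 Thm. (3.2)(2)]
[cite: MoonenZarhin1999LowDim, §2 (2.2)–(2.3)] -/
theorem finrank_hodgeLie_derived_hodge_one_eq_three_of_isIsogenous_powSucc_prod (hX : IsSmoothProjective n X.X)
    {B Z : AbelianVariety ℂ} {m : ℕ} (hBs : B.IsSimple) (hB0 : 0 < B.dim) (hB2 : B.dim ≤ 2) (hBcm : ¬ IsOfCMType B)
    (hfinB : Module.finrank ℚ B.endAlgebra = B.dim ^ 2) (hZB : Module.finrank ℚ (Subalgebra.center ℚ B.endAlgebra) = 1)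
    (hcm : IsOfCMType Z) (hXBZ : IsIsogenous X ((B.powSucc m).prod Z)) :
    haveI := BettiUniverse.finite hX 1
    Module.finrank ℚ ↥(Submodule.span ℚ {C | ∃ A ∈ (BettiUniverse.hodge exists_isReal_hodgeModel_holds hX 1).hodgeLie,
        ∃ D ∈ (BettiUniverse.hodge exists_isReal_hodgeModel_holds hX 1).hodgeLie, A * D - D * A = C}) = 3 := by
  have hA4 : HasNoTypeIVFactor B :=
    hasNoTypeIVFactor_of_center_le_bot (le_of_eq (Subalgebra.eq_bot_of_finrank_one hZB))
  rw [(finrank_hodgeLie_center_and_derived_hodge_one_eq_of_isIsogenous_powSucc_prod hX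
    (AbelianVariety.isSmoothProjective_holds (A := B)) (AbelianVariety.isSmoothProjective_holds (A := Z)) hA4 hcm hXBZ).2]
  exact finrank_hodgeLie_hodge_one_eq_three_of_factor hBs hB0 hB2 hBcm hfinB

/-- **The semisimple-rank-one rungs as an IFF** (`0 < dim X`): `dim [Lie Hg, Lie Hg](H¹X) = 3` — i.e. `Hg(X)` has
semisimple part `SL₂`-like of dimension three, any centre — iff `X ∼ B^{m+1} × Z` with `B` a SIMPLE non-CM curve or QM
abelian surface (`0 < dim B ≤ 2`, `dim_ℚ End⁰B = (dim B)²`, `Z(End⁰B) = ℚ`) and `Z` of CM type (Moonen–Zarhin's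
`SL₂ × torus` shapes).  `⟹`: `CorCM/MumfordTateRankSixIsogeny` (gen 37); `⟸`: §1 (new).
[cite: MoonenZarhin1999LowDim, §2 (2.1)–(2.5)] [cite: MoonenZarhin1999LowDim, §3 Thm. (3.2)(2)]
[cite: MumfordAV1970, §19 Thm. 1, Cor. 1–2 (pp. 173–174)] -/
theorem finrank_hodgeLie_derived_hodge_one_eq_three_iff (hX : IsSmoothProjective n X.X) (h0 : 0 < X.dim) :
    haveI := BettiUniverse.finite hX 1
    Module.finrank ℚ ↥(Submodule.span ℚ {C | ∃ A ∈ (BettiUniverse.hodge exists_isReal_hodgeModel_holds hX 1).hodgeLie,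
        ∃ D ∈ (BettiUniverse.hodge exists_isReal_hodgeModel_holds hX 1).hodgeLie, A * D - D * A = C}) = 3 ↔
      ∃ (B Z : AbelianVariety ℂ) (m : ℕ), B.IsSimple ∧ 0 < B.dim ∧ B.dim ≤ 2 ∧ ¬ IsOfCMType B ∧
        Module.finrank ℚ B.endAlgebra = B.dim ^ 2 ∧ Module.finrank ℚ (Subalgebra.center ℚ B.endAlgebra) = 1 ∧
        IsOfCMType Z ∧ IsIsogenous X ((B.powSucc m).prod Z) := by
  constructor
  · intro h3
    obtain ⟨B, Z, m, hBs, hB0, hB2, hBcm, hfinB, hZB, hcm, hXBZ, -, -⟩ :=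
      exists_isIsogenous_powSucc_prod_of_finrank_derived_eq_three hX h0 h3
    exact ⟨B, Z, m, hBs, hB0, hB2, hBcm, hfinB, hZB, hcm, hXBZ⟩
  · rintro ⟨B, Z, m, hBs, hB0, hB2, hBcm, hfinB, hZB, hcm, hXBZ⟩
    exact finrank_hodgeLie_derived_hodge_one_eq_three_of_isIsogenous_powSucc_prod hX hBs hB0 hB2 hBcm hfinB hZB hcm hXBZ

end Summit.HodgeConjecture.CorCM

end
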